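import Mathlib
import HarnessLib
import Summits.HubbardSuperconductivity.HubbardSuperconductivity.Theorems.KLProgrammeKLRegimeSplitTwoLegFrameLipschitzLiteral
import Summits.HubbardSuperconductivity.HubbardSuperconductivity.Theorems.KLProgrammeKLRegimeSplitTwoLegIncrementMomentsFromPosition

/-!
# Route `KLProgramme` — gen-5 ENGINE child, stub `stub_twoLeg_step`: (E3c) `FrameLipschitzFnT hist … K (n+1)` INCREMENT-RESOLVED —
# response and gradient of the INCREMENT `S_{n+1} − S_n` (frame vertex cancelled, scale gain visible), and both FROM POSITION-SPACE data

Cell `gate-hubbard-kl`, seat p1b (g6).  `…TwoLegFrameLipschitzV13` / `…Literal` (p486109 / p488419) bound `|ℓ_{n+1}(K.eval) − ℓ_{n+1}(K′.eval)|` by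
the responses and gradients of `S_{n+1}` and `S_n` SEPARATELY (`(r_{n+1} + r_n) + (b_{n+1} + b_n)·fd/D`); those are `O(U)` at every scale and do
not fit `lipBar G Q U (n+1) = (SL + SL′U)|U|4^{−(n+1)}` for `n ≥ 1` — the same non-resolution k3c3-p3 flagged for the sizes.  The cure is the same:
read the piece through its INCREMENT profile `δ = (S_{n+1}^K − S_n^K) ∘ k_F^K` — ONE reading function `Δ^K := S_{n+1}^K − S_n^K` (the frame vertex
`+K` cancels, and `Δ` carries the scale-`n` gain):
* §1 `abs_klTwoLegPieceFn_eval_succ_sub_le_sharp`: `|ℓ_{n+1}(K.eval)(q) − ℓ_{n+1}(K′.eval)(q)| ≤ r_Δ + b_Δ·frameDist K K′/(Dt_min − A)` with the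
  gradient `b_Δ` of `evalM S_{n+1}^K − evalM S_n^K` and the response `r_Δ` of `Δ` at the momenta `k_F^{K′}θ`;
* §2 `frameLipschitzFnT_succ_of_increment_responses`: the literal slot clause in the regime from a response MODULUS `ρ_Δ` (against every admissible
  `K′` with history) and `b_Δ`, fit `ρ_Δ + b_Δ/D ≤ lipBar G Q U (n+1)`;
* §3 POSITION bridges: `b_Δ ≤ 2Mˢ₁(ΔW^K)` (first pinned spatial moment of the increment kernel, p486520) — `norm_fderiv_increment_le_of_position_moment`;
  and `r_Δ ≤ 2·Mˢ₀(ΔW^K − ΔW^{K′})` (pinned ZEROTH moment of the increment kernels' difference ACROSS FRAMES — «the increment kernel is L¹-Lipschitz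
  in the frame») — `abs_increment_eval_sub_le_of_position_moment`.
Proofs only; nothing about the model is asserted.  References: FST IV Thm 2; BGM 2006 §2.4 [cite: BenfattoGiulianiMastropietro2006].
-/

noncomputable section

namespace Summit.HubbardSuperconductivity.HubbardSuperconductivity.Theorems.KLRegimeSplit

set_option linter.dupNamespace false -- summit = problem name (single-conjunct summit), D-0017

open Real Set MeasureTheory Finset
open Literature.MathematicalPhysics.QuantumLattice Literature.MathematicalPhysics.QuantumLattice.BandSectorCounting
open Literature.Probability.LatticeModels
open Summit.HubbardSuperconductivity.HubbardSuperconductivity.Theorems.DispersionFlow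
open Summit.HubbardSuperconductivity.HubbardSuperconductivity.Theorems.PerturbedFermiCurve
open Summit.HubbardSuperconductivity.HubbardSuperconductivity.Theorems.KLProgrammeLegKernels
open Summit.HubbardSuperconductivity.HubbardSuperconductivity.Theorems.TwoLegFourier

/-! ## §1 The increment-resolved two-frame bound -/

section Sharp

variable {L M : ℕ} [NeZero L] [NeZero M]
variable {a b : ℝ} (B : BandBounds a b) {K K' : TrigPolyC4v} {A : ℝ}
  (hA : ∀ p : Momentum, ∀ j ≤ 2, ‖iteratedFDeriv ℝ j (frameShift K) p‖ ≤ A)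
  (hA' : ∀ p : Momentum, ∀ j ≤ 2, ‖iteratedFDeriv ℝ j (frameShift K') p‖ ≤ A)
  (hADt : 2 * A < B.Dtmin) {μ : ℝ} (hlo : a ≤ μ - A) (hhi : μ + A ≤ b)
include B hA hA' hADt hlo hhi

/-- **(E3c) for `ℓ_{n+1}`, INCREMENT-RESOLVED**: with `Δ^X := S_{n+1}^X − S_n^X`, a gradient bound `‖D(evalM S_{n+1}^K − evalM S_n^K)‖ ≤ b_Δ` and the
response bound `|Δ^K(k_F^{K′}θ) − Δ^{K′}(k_F^{K′}θ)| ≤ r_Δ` for all `θ`: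
`|klTwoLegPieceFn … K.eval (n+1) q − klTwoLegPieceFn … K′.eval (n+1) q| ≤ r_Δ + b_Δ·frameDist K K′/(Dt_min − A)`. -/
theorem abs_klTwoLegPieceFn_eval_succ_sub_le_sharp {β U : ℝ} {n : ℕ} {bΔ rΔ : ℝ} (hbΔ : 0 ≤ bΔ)
    (hgrad : ∀ q : Momentum, ‖fderiv ℝ (fun q : Momentum =>
      evalM (symInterp L (klLocSelfEnergyRe L M β U μ K (n + 1))) q - evalM (symInterp L (klLocSelfEnergyRe L M β U μ K n)) q) q‖ ≤ bΔ)
    (hresp : ∀ θ : ℝ,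
      |((symInterp L (klLocSelfEnergyRe L M β U μ K (n + 1))).eval (klFermiPoint μ K' θ) -
          (symInterp L (klLocSelfEnergyRe L M β U μ K n)).eval (klFermiPoint μ K' θ)) -
        ((symInterp L (klLocSelfEnergyRe L M β U μ K' (n + 1))).eval (klFermiPoint μ K' θ) -
          (symInterp L (klLocSelfEnergyRe L M β U μ K' n)).eval (klFermiPoint μ K' θ))| ≤ rΔ)
    (q : Fin 2 → ℝ) :
    |klTwoLegPieceFn L M β U μ K.eval (n + 1) q - klTwoLegPieceFn L M β U μ K'.eval (n + 1) q| ≤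
      rΔ + bΔ * (frameDist K K' / (B.Dtmin - A)) := by
  have hA0 : 0 ≤ A := le_trans (norm_nonneg _) (hA 0 0 (by norm_num))
  have hA1 : A < B.Dtmin := by linarith
  set FK : FrameFn := fun p => (symInterp L (klLocSelfEnergyRe L M β U μ K (n + 1))).eval p -
    (symInterp L (klLocSelfEnergyRe L M β U μ K n)).eval p with hFK
  set FK' : FrameFn := fun p => (symInterp L (klLocSelfEnergyRe L M β U μ K' (n + 1))).eval p -
    (symInterp L (klLocSelfEnergyRe L M β U μ K' n)).eval p with hFK'
  have hδ : ∀ (X : TrigPolyC4v) (θ : ℝ), klLocalPart L M β U μ X (n + 1) θ - klLocalPart L M β U μ X n θ =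
      (fun p => (symInterp L (klLocSelfEnergyRe L M β U μ X (n + 1))).eval p -
        (symInterp L (klLocSelfEnergyRe L M β U μ X n)).eval p) (klFermiPointFn μ X.eval θ) := fun X θ => rfl
  have hcont : ∀ (X : TrigPolyC4v) (hX : ∀ p : Momentum, ∀ j ≤ 2, ‖iteratedFDeriv ℝ j (frameShift X) p‖ ≤ A) (m : ℕ),
      Continuous (klLocalPart L M β U μ X m) := fun X hX m =>
    (contDiff_klLocalPart B hX hADt hlo hhi L M β U m (m := 0)).continuous
  rw [klTwoLegPieceFn_eval_succ β U μ K n (hcont K hA (n + 1)) (hcont K hA n),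
    klTwoLegPieceFn_eval_succ β U μ K' n (hcont K' hA' (n + 1)) (hcont K' hA' n)]
  have hdiff : Differentiable ℝ (onM FK) := by
    have h : onM FK = fun q => evalM (symInterp L (klLocSelfEnergyRe L M β U μ K (n + 1))) q -
        evalM (symInterp L (klLocSelfEnergyRe L M β U μ K n)) q := rfl
    rw [h]; exact (differentiable_evalM _).sub (differentiable_evalM _)
  have hrad : ∀ θ s t : ℝ, s ∈ Icc 0 (π / ‖dir θ‖) → t ∈ Icc 0 (π / ‖dir θ‖) →
      |FK (s • dir θ) - FK (t • dir θ)| ≤ bΔ * |s - t| := fun θ => radialLipschitz_of_norm_fderiv_onM_le hdiff hgrad θ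
  have hprof : ∀ θ, |(klLocalPart L M β U μ K (n + 1) θ - klLocalPart L M β U μ K n θ) -
      (klLocalPart L M β U μ K' (n + 1) θ - klLocalPart L M β U μ K' n θ)| ≤ rΔ + bΔ * (frameDist K K' / (B.Dtmin - A)) := by
    intro θ
    rw [hδ K θ, hδ K' θ]
    have h := abs_apply_klFermiPointFn_sub_le_of_frames B (isSymmetricFrame_eval K) (isSymmetricFrame_eval K')
      (differentiable_evalM K) (differentiable_evalM K') (abs_eval_le_of_frameShift hA) (abs_eval_le_of_frameShift hA')
      (norm_fderiv_onM_eval_le_of_frameShift hA) hA1 hlo hhi FK FK' hbΔ (hrad θ) (θ := θ)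
    have h2 : |FK (klFermiPointFn μ K'.eval θ) - FK' (klFermiPointFn μ K'.eval θ)| ≤ rΔ := by
      simpa only [hFK, hFK', klFermiPointFn_eval] using hresp θ
    rw [frameDistFn_eval] at h
    linarith
  exact abs_klFrameExtFn_sub_klFrameExtFn_le μ
    (((hcont K hA (n + 1)).sub (hcont K hA n)).intervalIntegrable _ _)
    (((hcont K' hA' (n + 1)).sub (hcont K' hA' n)).intervalIntegrable _ _) hprof q

end Sharp

/-! ## §2 The literal slot clause, increment-resolved, in the KL regime -/

section Model

variable {L M : ℕ} [NeZero L] [NeZero M]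

/-- **`FrameLipschitzFnT … K (n+1)` FROM THE INCREMENT'S RESPONSE MODULUS AND GRADIENT.**  `∃ c₃ U₀ D > 0` (`D = Dt_min/2`): in the regime, for
`μ ∈ klWindowC` and admissible `K`, every history, packages, scale `n`: if `‖D(evalM S_{n+1}^K − evalM S_n^K)‖ ≤ b_Δ`, the INCREMENT responds to
admissible comparison frames `K′` (with history) by at most `ρ_Δ·frameDist K K′` at the momenta `k_F^{K′}θ`, and `ρ_Δ + b_Δ/D ≤ lipBar G Q U (n+1)`,
then `FrameLipschitzFnT L M hist G Q R β U μ K (n+1)`. -/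
theorem frameLipschitzFnT_succ_of_increment_responses (R : RenConsts) (hR : ∀ j, 0 ≤ R.Gfr j) :
    ∃ c₃ : ℝ, 0 < c₃ ∧ ∃ U₀ : ℝ, 0 < U₀ ∧ ∃ D : ℝ, 0 < D ∧
      ∀ c : ℝ, 0 < c → c ≤ c₃ → ∀ U : ℝ, 0 < U → U ≤ U₀ → ∀ β : ℝ, klBetaMin ≤ β → β ≤ Real.exp (c / U ^ 2) →
      ∀ μ ∈ klWindowC, ∀ K : TrigPolyC4v, FrameOK R U (nScales β) μ K →
        ∀ (L M : ℕ) [NeZero L] [NeZero M] (hist : TrigPolyC4v → ℕ → Prop) (G : GeoConsts) (Q : EngConsts) (n : ℕ) (bΔ ρΔ : ℝ),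
          0 ≤ bΔ →
          (∀ q : Momentum, ‖fderiv ℝ (fun q : Momentum =>
            evalM (symInterp L (klLocSelfEnergyRe L M β U μ K (n + 1))) q - evalM (symInterp L (klLocSelfEnergyRe L M β U μ K n)) q) q‖ ≤ bΔ) →
          (∀ K' : TrigPolyC4v, FrameOK R U (klTempScaleIdx β klE0) μ K' → (∀ j < n + 1, hist K' j) → ∀ θ : ℝ,
            |((symInterp L (klLocSelfEnergyRe L M β U μ K (n + 1))).eval (klFermiPoint μ K' θ) -
                (symInterp L (klLocSelfEnergyRe L M β U μ K n)).eval (klFermiPoint μ K' θ)) -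
              ((symInterp L (klLocSelfEnergyRe L M β U μ K' (n + 1))).eval (klFermiPoint μ K' θ) -
                (symInterp L (klLocSelfEnergyRe L M β U μ K' n)).eval (klFermiPoint μ K' θ))| ≤ ρΔ * frameDist K K') →
          ρΔ + bΔ / D ≤ lipBar G Q U (n + 1) →
            FrameLipschitzFnT L M hist G Q R β U μ K (n + 1) := by
  have ha : (-4 : ℝ) < -1.1 := by norm_num
  have hab : (-1.1 : ℝ) ≤ -0.1 := by norm_num
  have hb : (-0.1 : ℝ) < 0 := by norm_num
  set B := bandBounds ha hab hb with hBdef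
  have hDt := B.Dtmin_pos
  set κ : ℝ := min B.Dtmin (1 / 5) with hκdef
  have hκ : 0 < κ := lt_min hDt (by norm_num)
  obtain ⟨c₃, hc₃, U₀, hU₀, hthr⟩ := frame_thresholds hR hκ
  refine ⟨c₃, hc₃, U₀, hU₀, B.Dtmin / 2, by positivity, ?_⟩
  intro c hc hcle U hU hUle β hβmin hβc μ hμ K hK L M _ _ hist G Q n bΔ ρΔ hbΔ hg hr hfit K' hK' hhist q
  have hAf : ∀ p : Momentum, ∀ j ≤ 2, ‖iteratedFDeriv ℝ j (frameShift K) p‖ ≤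
      2 * R.Gfr 0 * |U| + 2 * R.Gfr 1 * U ^ 2 + R.Gfr 2 * (c / Real.log 4) := fun p j hj =>
    norm_iteratedFDeriv_frameShift_le_of_frameOK_regime hR hc.le hβmin hβc hK p hj
  have hAf' : ∀ p : Momentum, ∀ j ≤ 2, ‖iteratedFDeriv ℝ j (frameShift K') p‖ ≤
      2 * R.Gfr 0 * |U| + 2 * R.Gfr 1 * U ^ 2 + R.Gfr 2 * (c / Real.log 4) := fun p j hj =>
    norm_iteratedFDeriv_frameShift_le_of_frameOK_regime hR hc.le hβmin hβc hK' p hj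
  set A := 2 * R.Gfr 0 * |U| + 2 * R.Gfr 1 * U ^ 2 + R.Gfr 2 * (c / Real.log 4) with hAdef
  have h4A : 4 * A ≤ κ := hthr c U hc.le hcle hU hUle
  have hA0 : 0 ≤ A := le_trans (norm_nonneg _) (hAf 0 0 (by norm_num))
  have hκDt : κ ≤ B.Dtmin := min_le_left _ _
  have hκ5 : κ ≤ 1 / 5 := min_le_right _ _
  have hADt : 2 * A < B.Dtmin := by linarith
  have hA20 : A ≤ 1 / 20 := by linarith
  obtain ⟨hlo, hhi⟩ := klWindowC_margin hμ hA20
  have hb := abs_klTwoLegPieceFn_eval_succ_sub_le_sharp B hAf hAf' hADt hlo hhi hbΔ hg (hr K' hK' hhist) q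
  have hfd : 0 ≤ frameDist K K' := frameDist_nonneg K K'
  have hden : frameDist K K' / (B.Dtmin - A) ≤ frameDist K K' / (B.Dtmin / 2) :=
    div_le_div_of_nonneg_left hfd (by positivity) (by linarith)
  have h1 : ρΔ * frameDist K K' + bΔ * (frameDist K K' / (B.Dtmin / 2)) = (ρΔ + bΔ / (B.Dtmin / 2)) * frameDist K K' := by
    ring
  calc _ ≤ ρΔ * frameDist K K' + bΔ * (frameDist K K' / (B.Dtmin - A)) := hb
    _ ≤ ρΔ * frameDist K K' + bΔ * (frameDist K K' / (B.Dtmin / 2)) := by nlinarith [mul_le_mul_of_nonneg_left hden hbΔ]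
    _ = (ρΔ + bΔ / (B.Dtmin / 2)) * frameDist K K' := h1
    _ ≤ lipBar G Q U (n + 1) * frameDist K K' := mul_le_mul_of_nonneg_right hfit hfd

/-! ## §3 Position-space bridges for the two increment inputs -/

/-- **`b_Δ` from the increment kernel's first spatial moment**: `‖D(evalM S_{n+1}^K − evalM S_n^K)(q)‖ ≤ 2Mˢ₁(W^{(n+1)} − W^{(n)})`. -/
theorem norm_fderiv_increment_le_of_position_moment {β : ℝ} (hβ : 0 < β) (U μ : ℝ) (K : TrigPolyC4v) (n : ℕ) {Ms : ℝ}
    (hMs : ∀ (σ : Fin 2) (x₀ : SpaceTimeIdx L M), imagTimeWeight β M *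
      ∑ x ∈ (univ : Finset (Fin 2 → SpaceTimeIdx L M)).filter (fun x => x 0 = x₀),
        (1 + ((((x 1).2 - (x 0).2) 0).valMinAbs.natAbs : ℝ) + ((((x 1).2 - (x 0).2) 1).valMinAbs.natAbs : ℝ)) ^ 1 *
          ‖sectorisedKernel L M β (trivialMultiplier L M) (klEffectiveAction L M β U μ K klE0 (n + 1)) 2
              (![((0, σ), 0), ((0, σ), 1)] : Fin 2 → SectorLeg 1) x -
            sectorisedKernel L M β (trivialMultiplier L M) (klEffectiveAction L M β U μ K klE0 n) 2
              (![((0, σ), 0), ((0, σ), 1)] : Fin 2 → SectorLeg 1) x‖ ≤ Ms) (q : Momentum) :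
    ‖fderiv ℝ (fun q : Momentum =>
      evalM (symInterp L (klLocSelfEnergyRe L M β U μ K (n + 1))) q - evalM (symInterp L (klLocSelfEnergyRe L M β U μ K n)) q) q‖ ≤
      2 * Ms := by
  have hfun : (fun q : Momentum =>
      evalM (symInterp L (klLocSelfEnergyRe L M β U μ K (n + 1))) q - evalM (symInterp L (klLocSelfEnergyRe L M β U μ K n)) q) =
      evalM (symInterp L fun k => klLocSelfEnergyRe L M β U μ K (n + 1) k - klLocSelfEnergyRe L M β U μ K n k) := by
    funext q; simp only [evalM_apply, eval_symInterp_sub]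
  rw [hfun, ← norm_iteratedFDeriv_one]
  exact (norm_iteratedFDeriv_evalM_le_coeffNorm _ 1 q).trans ((coeffNorm_symInterp_le _ 1).trans
    (sum_weight_abs_torusCosCoeff_klLocSelfEnergyRe_sub_le hβ U μ K n 1 hMs))

/-- **`r_Δ` from the pinned ZEROTH moment of the increment kernels' difference ACROSS FRAMES**: with `ΔV^X := V^X_{n+1} − V^X_n`
(`V^X_m = klEffectiveAction … X klE0 m`), if the unsectorised position two-leg kernel of `ΔV^K − ΔV^{K′}` has pinned `L¹` size `≤ Mˢ₀` (both spins),
then `|Δ^K(p) − Δ^{K′}(p)| ≤ 2Mˢ₀` at EVERY momentum `p` (in particular at `k_F^{K′}θ`). -/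
theorem abs_increment_eval_sub_le_of_position_moment {β : ℝ} (hβ : 0 < β) (U μ : ℝ) (K K' : TrigPolyC4v) (n : ℕ) {Ms : ℝ}
    (hMs : ∀ (σ : Fin 2) (x₀ : SpaceTimeIdx L M), imagTimeWeight β M *
      ∑ x ∈ (univ : Finset (Fin 2 → SpaceTimeIdx L M)).filter (fun x => x 0 = x₀),
        (1 + ((((x 1).2 - (x 0).2) 0).valMinAbs.natAbs : ℝ) + ((((x 1).2 - (x 0).2) 1).valMinAbs.natAbs : ℝ)) ^ 0 *
          ‖sectorisedKernel L M β (trivialMultiplier L M)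
              ((klEffectiveAction L M β U μ K klE0 (n + 1) - klEffectiveAction L M β U μ K klE0 n) -
                (klEffectiveAction L M β U μ K' klE0 (n + 1) - klEffectiveAction L M β U μ K' klE0 n)) 2
              (![((0, σ), 0), ((0, σ), 1)] : Fin 2 → SectorLeg 1) x‖ ≤ Ms) (p : Fin 2 → ℝ) :
    |((symInterp L (klLocSelfEnergyRe L M β U μ K (n + 1))).eval p - (symInterp L (klLocSelfEnergyRe L M β U μ K n)).eval p) -
        ((symInterp L (klLocSelfEnergyRe L M β U μ K' (n + 1))).eval p - (symInterp L (klLocSelfEnergyRe L M β U μ K' n)).eval p)| ≤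
      2 * Ms := by
  -- the double difference of the data is the data of the Grassmann double difference
  set G₁ := klEffectiveAction L M β U μ K klE0 (n + 1) - klEffectiveAction L M β U μ K klE0 n with hG₁
  set G₀ := klEffectiveAction L M β U μ K' klE0 (n + 1) - klEffectiveAction L M β U μ K' klE0 n with hG₀
  have hmom := sum_weight_abs_torusCosCoeff_locAvg_sub_le (L := L) (M := M) hβ G₁ G₀ 0 hMs
  -- identify the data
  have hdata : (fun k : TorusSite 2 L =>
      (∑ σ : Fin 2, ((selfEnergy L M β G₁ (omega0 M, k) σ).re + (selfEnergy L M β G₁ ((omega0 M).rev, k) σ).re)) / 4 -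
      (∑ σ : Fin 2, ((selfEnergy L M β G₀ (omega0 M, k) σ).re + (selfEnergy L M β G₀ ((omega0 M).rev, k) σ).re)) / 4) =
      fun k => (klLocSelfEnergyRe L M β U μ K (n + 1) k - klLocSelfEnergyRe L M β U μ K n k) -
        (klLocSelfEnergyRe L M β U μ K' (n + 1) k - klLocSelfEnergyRe L M β U μ K' n k) := by
    have e : ∀ (X : TrigPolyC4v) (m : ℕ) (k : TorusSite 2 L), klLocSelfEnergyRe L M β U μ X m k =
        (∑ σ : Fin 2, ((selfEnergy L M β (klEffectiveAction L M β U μ X klE0 m) (omega0 M, k) σ).re +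
          (selfEnergy L M β (klEffectiveAction L M β U μ X klE0 m) ((omega0 M).rev, k) σ).re)) / 4 := fun _ _ _ => rfl
    funext k
    simp only [e, hG₁, hG₀, selfEnergy_sub, Complex.sub_re, Finset.sum_add_distrib, Finset.sum_sub_distrib]
    ring
  rw [hdata] at hmom
  -- the value of the interpolant at `p` is bounded by the zeroth coefficient moment
  have hev : ((symInterp L (klLocSelfEnergyRe L M β U μ K (n + 1))).eval p - (symInterp L (klLocSelfEnergyRe L M β U μ K n)).eval p) -
      ((symInterp L (klLocSelfEnergyRe L M β U μ K' (n + 1))).eval p - (symInterp L (klLocSelfEnergyRe L M β U μ K' n)).eval p) =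
      evalM (symInterp L fun k => (klLocSelfEnergyRe L M β U μ K (n + 1) k - klLocSelfEnergyRe L M β U μ K n k) -
        (klLocSelfEnergyRe L M β U μ K' (n + 1) k - klLocSelfEnergyRe L M β U μ K' n k)) (WithLp.toLp 2 p) := by
    simp only [evalM_apply, eval_symInterp_sub]
  rw [hev, ← Real.norm_eq_abs, ← norm_iteratedFDeriv_zero (𝕜 := ℝ)]
  exact (norm_iteratedFDeriv_evalM_le_coeffNorm _ 0 _).trans ((coeffNorm_symInterp_le _ 0).trans hmom)

end Model

end Summit.HubbardSuperconductivity.HubbardSuperconductivity.Theorems.KLRegimeSplit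

end
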